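import Summits.ABC.IUTFork.Cor312ProvenanceQ
import Summits.ABC.IUTFork.Cor312ProvenanceThetaIdeal
import Literature.NumberTheory.EllipticCurves.MultiplicativeReductionJValuationProofs
import HarnessLib

/-!
# [IUTchIII] Cor. 3.12 provenance, DH side: the Dupuy–Hilado pilot datum OF a collection of initial Θ-data — a REAL
# inhabitant of `Cor312Prov.IsPilotDataOf` (non-vacuity witness for the adjudication record)

Record-only companion (seat abc-iut-w5-d231, gen 2; WAVE-5 D-0068) of abc-iut-c312-8's `Cor312ProvenanceDH.lean`;
TAKES NO SIDE on [IUTchIII] Cor. 3.12. The hypothesis structure `Cor312Prov.IsPilotDataOf D X` ("the Dupuy–Hilado pilot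
datum `X = (F, j_E, S, l)` is THE ONE of the initial Θ-data `D`": same `l`, `S = 𝕍(F)^bad`, `ord_v(q_v) = −ord_v(j_E)`) is
bound by the provenance theorems of `Cor312ProvenanceDH/Scale/ThetaIdeal.lean` but — kernel census of abc-iut-w5-d231
gen 0 (2026-08-26T01:14Z) and abc-iut-w5-d109's inhabitant census (02:25Z) — had NO inhabitant at ANY instance in the tree.
This file CONSTRUCTS the inhabitant at the genuine arithmetic data (no toy):

* `pilotDataOfF D : PilotData F` — c312-3's Dupuy–Hilado pilot datum ([cite: DupuyHilado2025, §3.3]: "`(F, j_E, S, l)` …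
  `S` the places of bad multiplicative reduction") OF `D` over `F` itself: `j_E := j(E_F)`, `S := 𝕍(F)^bad` ([IUTchI] Def.
  3.1 (b): "the elements of `𝕍(F)` that lie over `𝕍^bad_mod`", L5-t2's `InitialThetaData.VFbad`, finite by c312-8's PROVED
  `vFbad_finite`, nonempty by c312-8's PROVED `vFbad_nonempty`), `l := l`; the field `ord_jE_neg` ("`ord_v(j_E) < 0`") is
  Tate's `ord_v(j_E) = −ord_v(Δ_min) < 0` at a multiplicative place (the tree's DISCHARGED
  `log_valuation_j_eq_ordMinimalDiscriminant_of_hasMultiplicativeReductionAt` + `ordMinimalDiscriminant_eq_zero_iff_holds`,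
  Silverman AEC VII.5.1);
* `isPilotDataOf_pilotDataOfF : IsPilotDataOf D (pilotDataOfF D)` and `exists_isPilotDataOf` — the structure is INHABITED
  for EVERY collection of initial Θ-data (the companion `pilotData D : PilotData (fieldOfModuli E)` of abc-iut-S2's
  `InitialThetaDataVolume.lean` is the `F_mod`-level twin; `IsPilotDataOf` asks for the `F`-level datum);
* hX-FREE corollaries: `logq_eq_ndeg_qDivisor_pilotDataOfF` (`log(q) = deĝ̲_F(𝔮)`), `absLogq_eq_ndeg_qPilot_pilotDataOfF`
  (`|log(q)| = deĝ̲_F(P_q)`) and, over `F : Type`, `ndeg_thetaPilot_pilotDataOfF` (`deĝ̲_F(P_{Θ,j}) = j²·|log(q)|` for the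
  Θ-pilot divisors of the datum's own pilot data) — c312-8's theorems with the DH-datum hypothesis DISCHARGED.

All inputs BY NAME; no new `Prop` definition; nothing restated. [claim: Mochizuki2012, status: disputed] for the IUT
quotations; [cite: DupuyHilado2025, §3.3] for the DH conventions. Typed ≠ proved except where a theorem says PROVED
(everything below is proved); instantiated ≠ endorsed.
-/

noncomputable section

namespace Summit.ABC.IUTFork.Cor312Prov

open Literature.IUT.HodgeTheaters Literature.IUT.LogVolume NumberField IsDedekindDomain

universe u v w

section Witness

variable {F : Type u} {K : Type v} {Fbar : Type w} [Field F] [NumberField F] [Field K] [NumberField K]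
  [Algebra F K] [Field Fbar] [Algebra F Fbar] [Algebra K Fbar] {E : WeierstrassCurve F} [E.IsElliptic]
  {l : ℕ} {Pb : BadPlacePredicates K}

/-- **`ord_v(j_E) < 0` at every `v ∈ 𝕍(F)^bad`** ([IUTchI] Def. 3.1 (b): `E_F` has multiplicative reduction at the places
over `𝕍^bad_mod`; Tate/Silverman AEC VII.5.1: there `ord_v(j_E) = −ord_v(Δ_min)` and `ord_v(Δ_min) ≠ 0`). PROVED,
universe-polymorphically, from the tree's discharged `log_valuation_j_eq_ordMinimalDiscriminant_of_hasMultiplicativeReductionAt`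
and `ordMinimalDiscriminant_eq_zero_iff_holds`. [cite: DupuyHilado2025, §3.3] -/
theorem ord_j_neg_of_mem_VFbad (D : InitialThetaData F K Fbar E l Pb) {v : FinitePlace F} (hv : v ∈ D.VFbad) :
    ord F v.maximalIdeal E.j < 0 := by
  have hmult := D.multiplicative_over_VbadMod v hv
  have h := E.log_valuation_j_eq_ordMinimalDiscriminant_of_hasMultiplicativeReductionAt v.maximalIdeal hmult
  have h1 : 1 ≤ qParamOrd E v.maximalIdeal := one_le_qParamOrd D hv
  unfold qParamOrd at h1
  unfold ord
  rw [h]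
  omega

open scoped Classical in
/-- **The Dupuy–Hilado pilot datum OF the initial Θ-data `D`, over `F`**: `(j_E, S := 𝕍(F)^bad, l)` — c312-3's `PilotData F`
([cite: DupuyHilado2025, §3.3] "`(F, j_E, S, l)`"; [IUTchI] Def. 3.1 (b),(c)), every field a projection of `D` or a theorem
about it (`S` finite and nonempty: c312-8's `vFbad_finite` / `vFbad_nonempty`; `ord_v(j_E) < 0`: `ord_j_neg_of_mem_VFbad`).
[claim: Mochizuki2012, status: disputed] -/
def pilotDataOfF (D : InitialThetaData F K Fbar E l Pb) : PilotData F where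
  jE := E.j
  S := (vFbad_finite D).toFinset.image FinitePlace.maximalIdeal
  S_nonempty := by
    obtain ⟨v, hv⟩ := vFbad_nonempty D
    exact ⟨v.maximalIdeal, Finset.mem_image_of_mem _ ((vFbad_finite D).mem_toFinset.mpr hv)⟩
  ord_jE_neg := by
    intro x hx
    obtain ⟨v, hv, rfl⟩ := Finset.mem_image.mp hx
    exact ord_j_neg_of_mem_VFbad D ((vFbad_finite D).mem_toFinset.mp hv)
  l := l
  l_prime := D.l_prime
  five_le_l := D.five_le_l

/-- Its `l` is `D`'s `l`. [claim: Mochizuki2012, status: disputed] -/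
@[simp] theorem pilotDataOfF_l (D : InitialThetaData F K Fbar E l Pb) : (pilotDataOfF D).l = l := rfl

/-- Its `j`-invariant is `j(E_F)`. [claim: Mochizuki2012, status: disputed] -/
@[simp] theorem pilotDataOfF_jE (D : InitialThetaData F K Fbar E l Pb) : (pilotDataOfF D).jE = E.j := rfl

/-- Its bad set is `𝕍(F)^bad`, read through Mathlib's bijection `FinitePlace.maximalIdeal`: a prime `v.maximalIdeal` lies in
`S` iff `v ∈ 𝕍(F)^bad`. [claim: Mochizuki2012, status: disputed] -/
theorem maximalIdeal_mem_pilotDataOfF_S_iff (D : InitialThetaData F K Fbar E l Pb) (v : FinitePlace F) :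
    v.maximalIdeal ∈ (pilotDataOfF D).S ↔ v ∈ D.VFbad := by
  classical
  show v.maximalIdeal ∈ (vFbad_finite D).toFinset.image FinitePlace.maximalIdeal ↔ _
  rw [Finset.mem_image]
  constructor
  · rintro ⟨w, hw, hwv⟩
    rw [← FinitePlace.maximalIdeal_injective hwv]
    exact (vFbad_finite D).mem_toFinset.mp hw
  · intro hv
    exact ⟨v, (vFbad_finite D).mem_toFinset.mpr hv, rfl⟩

/-- A prime of `𝓞_F` lies in `S` iff its finite place lies in `𝕍(F)^bad`. [claim: Mochizuki2012, status: disputed] -/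
theorem mem_pilotDataOfF_S_iff (D : InitialThetaData F K Fbar E l Pb) (x : HeightOneSpectrum (𝓞 F)) :
    x ∈ (pilotDataOfF D).S ↔ FinitePlace.mk x ∈ D.VFbad := by
  rw [← maximalIdeal_mem_pilotDataOfF_S_iff D (FinitePlace.mk x), FinitePlace.maximalIdeal_mk]

/-- **`IsPilotDataOf D (pilotDataOfF D)`** — the hypothesis structure of `Cor312ProvenanceDH.lean` is INHABITED at the genuine
datum: same `l` (`rfl`), `S = 𝕍(F)^bad` (by construction), and DH's `ord_v(q_v) := −ord_v(j_E)` equals [IUTchI] Def. 3.1 (c)'s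
`ord_v(q_v) := ord_v(Δ_min)` at every `v ∈ 𝕍(F)^bad` (Tate uniformisation at a multiplicative place, the tree's discharged
`log_valuation_j_eq_ordMinimalDiscriminant_of_hasMultiplicativeReductionAt`). PROVED. [cite: DupuyHilado2025, §3.3] -/
theorem isPilotDataOf_pilotDataOfF (D : InitialThetaData F K Fbar E l Pb) : IsPilotDataOf D (pilotDataOfF D) where
  l_eq := rfl
  mem_S_iff := maximalIdeal_mem_pilotDataOfF_S_iff D
  ordq_eq v hv := by
    unfold PilotData.ordq ord qParamOrd
    rw [pilotDataOfF_jE, neg_neg]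
    exact E.log_valuation_j_eq_ordMinimalDiscriminant_of_hasMultiplicativeReductionAt v.maximalIdeal
      (D.multiplicative_over_VbadMod v hv)

/-- **Non-vacuity of `IsPilotDataOf`**: every collection of initial Θ-data HAS a Dupuy–Hilado pilot datum attached to it.
PROVED. [cite: DupuyHilado2025, §3.3] -/
theorem exists_isPilotDataOf (D : InitialThetaData F K Fbar E l Pb) : ∃ X : PilotData F, IsPilotDataOf D X :=
  ⟨pilotDataOfF D, isPilotDataOf_pilotDataOfF D⟩

/-- `log(q) = deĝ̲_F(𝔮)` for the datum's OWN pilot data — c312-8's `logq_eq_ndeg_qDivisor` with the DH hypothesis discharged.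
PROVED. [cite: DupuyHilado2025, §3.3] -/
theorem logq_eq_ndeg_qDivisor_pilotDataOfF (D : InitialThetaData F K Fbar E l Pb) :
    logq D = FinDivisor.ndeg F (pilotDataOfF D).qDivisor :=
  logq_eq_ndeg_qDivisor (isPilotDataOf_pilotDataOfF D)

/-- `|log(q)| = deĝ̲_F(P_q)` for the datum's OWN pilot data — c312-8's `absLogq_eq_ndeg_qPilot` with the DH hypothesis
discharged (Dupuy–Hilado's "`−|log(q)| = −deĝ(P_q)`" dictionary at the genuine datum). PROVED. [cite: DupuyHilado2025, §3.3] -/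
theorem absLogq_eq_ndeg_qPilot_pilotDataOfF (D : InitialThetaData F K Fbar E l Pb) :
    absLogq D = FinDivisor.ndeg F (pilotDataOfF D).qPilot :=
  absLogq_eq_ndeg_qPilot (isPilotDataOf_pilotDataOfF D)

end Witness

section ThetaPilot

variable {F : Type} {K : Type v} {Fbar : Type w} [Field F] [NumberField F] [Field K] [NumberField K]
  [Algebra F K] [Field Fbar] [Algebra F Fbar] [Algebra K Fbar] {E : WeierstrassCurve F} [E.IsElliptic]
  {l : ℕ} {Pb : BadPlacePredicates K}

/-- **`deĝ̲_F(P_{Θ,j}) = j²·|log(q)|`** (`j = 1, …, l⋆`) for the Θ-pilot divisors of the pilot data OF the initial Θ-data —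
abc-iut-c312-8's `ndeg_thetaPilot_eq_sq_mul_absLogq` (over c312-3's `P_{Θ,j} = j²·P_q`) with the DH-datum hypothesis
DISCHARGED by `isPilotDataOf_pilotDataOfF`. PROVED. [cite: DupuyHilado2025, §3.3] -/
theorem ndeg_thetaPilot_pilotDataOfF (D : InitialThetaData F K Fbar E l Pb) (i : Fin (pilotDataOfF D).lstar) :
    FinDivisor.ndeg F ((pilotDataOfF D).thetaPilot i) = (((i : ℕ) + 1 : ℝ) ^ 2) * absLogq D :=
  ndeg_thetaPilot_eq_sq_mul_absLogq (isPilotDataOf_pilotDataOfF D) i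

/-- The number of Θ-pilot components of the datum's pilot data is `l⋆ = (l − 1)/2`. [claim: Mochizuki2012, status: disputed] -/
theorem pilotDataOfF_lstar (D : InitialThetaData F K Fbar E l Pb) : (pilotDataOfF D).lstar = (l - 1) / 2 := rfl

end ThetaPilot

end Summit.ABC.IUTFork.Cor312Prov

end
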